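import Literature.Probability.LatticeModels.ProdBernoulliIndependence
import HarnessLib

/-!
# QUANT lane R8 — one step down a relay's chain: splitting "at least two / at least one reached" at the top level

builds on p205010 (kernel theorem, internal audit signed; external expert review pending)

Support file (`--supports stmt-CriticalPhenomena-4575`), QUANT lane lead (gen 8), rung R8 of
`run/shared/lean/prim/quant/LADDER.md`; memo `prim-quant-lead-g7/LEAD-NOTES-G7.md` N17 Step 1 (the chain identity), in the inductive
form used by `…QuantFarTreeMultiCompanion.lean`.  Generic (no tree yet): gate coordinates `prodBernoulli q` on `Set ι`, witnesses
indexed by `κ`, witness `y` "reached" iff its finset `A y` is open (`↑(A y) ⊆ ω`).  Theorems only; no sorries; standard axioms.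

**The step.**  Two disjoint finite families of witnesses: `S₁` (the TOP LEVEL: `A b = K ∪ I b` with a common part `K`, the open chain
prefix, and inner parts `I b`) and `S₂` (the REST: every `A y ⊇ K`).  Write `N = #{y ∈ S₁ ∪ S₂ reached}`, `C = #{b ∈ S₁ : I b open}`,
`Y = #{y ∈ S₂ reached}`.  Then pointwise `N = 1[K open]·C + Y` and `Y ≥ 1 ⟹ K open` (`Quant.count_split`), whence the event identities
`{N ≥ 2} = {K open, C ≥ 2} ⊔ {C = 1, Y ≥ 1} ⊔ {C = 0, Y ≥ 2}` and `{N ≥ 1} = {K open, C ≥ 1} ⊔ {C = 0, Y ≥ 1}`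
(`Quant.two_le_count_eq`, `Quant.one_le_count_eq`).  If `K`, the inner parts, and the sets of the rest are supported on pairwise disjoint
coordinates, independence (`prodBernoulli_real_inter_of_determinedBy_disjoint`) gives
`P(N ≥ 2) = π(K)·P(C ≥ 2) + P(C = 1)·P(Y ≥ 1) + P(C = 0)·P(Y ≥ 2)`, `P(N ≥ 1) = π(K)·(1 − P(C = 0)) + P(C = 0)·P(Y ≥ 1)`
(`Quant.chain_step_real`) — the recursion `E W(l :: L) = t·w + s·F(L) + z·E W(L)`, `F(l :: L) = (1 − z)·w + z·F(L)` of
`…QuantSecondWeightLevels.lean` with `(z, s, t) = (P(C = 0), P(C = 1), P(C ≥ 2))`, `w = π(K)`.  Also: the three probabilities sum to `1`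
(`Quant.count_trichotomy_real`), the moment sandwich `P(C = 1) ≤ Σ_{b ∈ S₁} π(I b) ≤ P(C = 1) + |S₁|·P(C ≥ 2)` (`Quant.count_moment_bounds`),
and the `DeterminedBy` bookkeeping.  [this work]; independence of disjointly supported events [cite: Grimmett1999, §2.2].
-/

noncomputable section

namespace Summit.CriticalPhenomena.PercolationContinuityZ3.Theorems

namespace Quant

open Finset MeasureTheory
open Literature.Probability.LatticeModels
open Literature.Probability.Percolation
open scoped Classical

variable {ι κ : Type*}

/-! ### `DeterminedBy` bookkeeping -/

/-- "`K` is open" is determined by `K`. [folklore] -/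
theorem determinedBy_subset_open (K : Finset ι) : DeterminedBy {ω : Set ι | (K : Set ι) ⊆ ω} (↑K : Set ι) := by
  rw [determinedBy_iff]
  intro ω ω' h
  simp only [Set.mem_setOf_eq]
  constructor
  · intro hω i hi
    have : i ∈ ω ∩ ↑K := ⟨hω hi, hi⟩
    rw [h] at this; exact this.1
  · intro hω i hi
    have : i ∈ ω' ∩ ↑K := ⟨hω hi, hi⟩
    rw [← h] at this; exact this.1

/-- Any event read off the number of witnesses of `S` whose sets `I b ⊆ F` are open is determined by `F`. [folklore] -/
theorem determinedBy_card_filter_open (S : Finset κ) (I : κ → Finset ι) (F : Finset ι) (hI : ∀ b ∈ S, I b ⊆ F) (Φ : ℕ → Prop) :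
    DeterminedBy {ω : Set ι | Φ ((S.filter fun b => ((I b : Finset ι) : Set ι) ⊆ ω).card)} (↑F : Set ι) := by
  rw [determinedBy_iff]
  intro ω ω' h
  have hfilt : (S.filter fun b => ((I b : Finset ι) : Set ι) ⊆ ω) = (S.filter fun b => ((I b : Finset ι) : Set ι) ⊆ ω') := by
    refine Finset.filter_congr fun b hb => ?_
    constructor
    · intro hω i hi
      have : i ∈ ω ∩ ↑F := ⟨hω hi, hI b hb (Finset.mem_coe.1 hi)⟩
      rw [h] at this; exact this.1
    · intro hω i hi
      have : i ∈ ω' ∩ ↑F := ⟨hω hi, hI b hb (Finset.mem_coe.1 hi)⟩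
      rw [← h] at this; exact this.1
  simp only [Set.mem_setOf_eq, hfilt]

/-! ### The pointwise count split and the event identities -/

/-- **Pointwise split.**  With `A b = K ∪ I b` on `S₁` and `K ⊆ A y` on `S₂` (disjoint families):
`#{y ∈ S₁ ∪ S₂ : A y open} = 1[K open]·#{b ∈ S₁ : I b open} + #{y ∈ S₂ : A y open}`, and a reached witness of `S₂` forces `K` open. [this work] -/
theorem count_split (A I : κ → Finset ι) (K : Finset ι) (S₁ S₂ : Finset κ) (hdisj : Disjoint S₁ S₂)
    (hA₁ : ∀ b ∈ S₁, A b = K ∪ I b) (hA₂ : ∀ y ∈ S₂, K ⊆ A y) (ω : Set ι) :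
    ((S₁ ∪ S₂).filter fun y => ((A y : Finset ι) : Set ι) ⊆ ω).card =
        (if ((K : Finset ι) : Set ι) ⊆ ω then (S₁.filter fun b => ((I b : Finset ι) : Set ι) ⊆ ω).card else 0) +
          (S₂.filter fun y => ((A y : Finset ι) : Set ι) ⊆ ω).card ∧
      (1 ≤ (S₂.filter fun y => ((A y : Finset ι) : Set ι) ⊆ ω).card → ((K : Finset ι) : Set ι) ⊆ ω) := by
  constructor
  · rw [Finset.filter_union, Finset.card_union_of_disjoint (Finset.disjoint_filter_filter hdisj)]
    congr 1
    split_ifs with hK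
    · congr 1
      refine Finset.filter_congr fun b hb => ?_
      rw [hA₁ b hb, Finset.coe_union, Set.union_subset_iff]
      exact ⟨fun h => h.2, fun h => ⟨hK, h⟩⟩
    · rw [Finset.card_eq_zero, Finset.filter_eq_empty_iff]
      intro b hb hAb
      rw [hA₁ b hb, Finset.coe_union, Set.union_subset_iff] at hAb
      exact hK hAb.1
  · intro h1
    obtain ⟨y, hy⟩ := Finset.card_pos.1 h1
    rw [Finset.mem_filter] at hy
    exact subset_trans (Finset.coe_subset.2 (hA₂ y hy.1)) hy.2

/-- **`{N ≥ 2}` split at the top level**: `{K open, C ≥ 2} ∪ {C = 1, Y ≥ 1} ∪ {C = 0, Y ≥ 2}`. [this work] -/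
theorem two_le_count_eq (A I : κ → Finset ι) (K : Finset ι) (S₁ S₂ : Finset κ) (hdisj : Disjoint S₁ S₂)
    (hA₁ : ∀ b ∈ S₁, A b = K ∪ I b) (hA₂ : ∀ y ∈ S₂, K ⊆ A y) :
    {ω : Set ι | 2 ≤ ((S₁ ∪ S₂).filter fun y => ((A y : Finset ι) : Set ι) ⊆ ω).card} =
      ({ω : Set ι | ((K : Finset ι) : Set ι) ⊆ ω} ∩ {ω | 2 ≤ (S₁.filter fun b => ((I b : Finset ι) : Set ι) ⊆ ω).card}) ∪
        ({ω : Set ι | (S₁.filter fun b => ((I b : Finset ι) : Set ι) ⊆ ω).card = 1} ∩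
          {ω | 1 ≤ (S₂.filter fun y => ((A y : Finset ι) : Set ι) ⊆ ω).card}) ∪
        ({ω : Set ι | (S₁.filter fun b => ((I b : Finset ι) : Set ι) ⊆ ω).card = 0} ∩
          {ω | 2 ≤ (S₂.filter fun y => ((A y : Finset ι) : Set ι) ⊆ ω).card}) := by
  ext ω
  obtain ⟨hN, hY⟩ := count_split A I K S₁ S₂ hdisj hA₁ hA₂ ω
  simp only [Set.mem_setOf_eq, Set.mem_union, Set.mem_inter_iff]
  rw [hN]
  by_cases hK : ((K : Finset ι) : Set ι) ⊆ ω
  · simp only [hK, ↓reduceIte, true_and]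
    omega
  · simp only [hK, ↓reduceIte, false_and, false_or, zero_add]
    have hY0 : (S₂.filter fun y => ((A y : Finset ι) : Set ι) ⊆ ω).card < 1 := by
      by_contra h
      exact hK (hY (not_lt.1 h))
    omega

/-- **`{N ≥ 1}` split at the top level**: `{K open, C ≥ 1} ∪ {C = 0, Y ≥ 1}`. [this work] -/
theorem one_le_count_eq (A I : κ → Finset ι) (K : Finset ι) (S₁ S₂ : Finset κ) (hdisj : Disjoint S₁ S₂)
    (hA₁ : ∀ b ∈ S₁, A b = K ∪ I b) (hA₂ : ∀ y ∈ S₂, K ⊆ A y) :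
    {ω : Set ι | 1 ≤ ((S₁ ∪ S₂).filter fun y => ((A y : Finset ι) : Set ι) ⊆ ω).card} =
      ({ω : Set ι | ((K : Finset ι) : Set ι) ⊆ ω} ∩ {ω | 1 ≤ (S₁.filter fun b => ((I b : Finset ι) : Set ι) ⊆ ω).card}) ∪
        ({ω : Set ι | (S₁.filter fun b => ((I b : Finset ι) : Set ι) ⊆ ω).card = 0} ∩
          {ω | 1 ≤ (S₂.filter fun y => ((A y : Finset ι) : Set ι) ⊆ ω).card}) := by
  ext ω
  obtain ⟨hN, hY⟩ := count_split A I K S₁ S₂ hdisj hA₁ hA₂ ω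
  simp only [Set.mem_setOf_eq, Set.mem_union, Set.mem_inter_iff]
  rw [hN]
  by_cases hK : ((K : Finset ι) : Set ι) ⊆ ω
  · simp only [hK, ↓reduceIte, true_and]
    omega
  · simp only [hK, ↓reduceIte, false_and, false_or, zero_add]
    have hY0 : (S₂.filter fun y => ((A y : Finset ι) : Set ι) ⊆ ω).card < 1 := by
      by_contra h
      exact hK (hY (not_lt.1 h))
    omega

/-! ### Probabilities -/

variable [Finite ι]

/-- The three count classes `C = 0`, `C = 1`, `C ≥ 2` have total probability one. [folklore] -/
theorem count_trichotomy_real (q : ι → unitInterval) (S : Finset κ) (I : κ → Finset ι) :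
    (prodBernoulli q).real {ω : Set ι | (S.filter fun b => ((I b : Finset ι) : Set ι) ⊆ ω).card = 0} +
        (prodBernoulli q).real {ω : Set ι | (S.filter fun b => ((I b : Finset ι) : Set ι) ⊆ ω).card = 1} +
        (prodBernoulli q).real {ω : Set ι | 2 ≤ (S.filter fun b => ((I b : Finset ι) : Set ι) ⊆ ω).card} = 1 := by
  set μ := prodBernoulli q with hμ
  have hmeas : ∀ T : Set (Set ι), MeasurableSet T := fun T => (Set.toFinite T).measurableSet
  set E0 := {ω : Set ι | (S.filter fun b => ((I b : Finset ι) : Set ι) ⊆ ω).card = 0} with hE0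
  set E1 := {ω : Set ι | (S.filter fun b => ((I b : Finset ι) : Set ι) ⊆ ω).card = 1} with hE1
  set E2 := {ω : Set ι | 2 ≤ (S.filter fun b => ((I b : Finset ι) : Set ι) ⊆ ω).card} with hE2
  have hd01 : Disjoint E0 E1 := by
    rw [Set.disjoint_left]; intro ω h0 h1
    simp only [hE0, hE1, Set.mem_setOf_eq] at h0 h1; omega
  have hd2 : Disjoint (E0 ∪ E1) E2 := by
    rw [Set.disjoint_left]; intro ω h01 h2
    simp only [hE0, hE1, hE2, Set.mem_setOf_eq, Set.mem_union] at h01 h2; omega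
  have huniv : E0 ∪ E1 ∪ E2 = Set.univ := by
    ext ω
    simp only [hE0, hE1, hE2, Set.mem_setOf_eq, Set.mem_union, Set.mem_univ, iff_true]; omega
  have := probReal_univ (μ := μ)
  rw [← huniv, measureReal_union hd2 (hmeas _), measureReal_union hd01 (hmeas _)] at this
  exact this

/-- **Moment sandwich** for the count `C = #{b ∈ S : I b open}`:
`P(C = 1) ≤ Σ_{b ∈ S} π(I b) ≤ P(C = 1) + |S|·P(C ≥ 2)` (`Σ_b π(I b) = E C`; lower: union bound; upper: the events
`{I b open, C = 1}` are pairwise disjoint). [this work] -/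
theorem count_moment_bounds (q : ι → unitInterval) (S : Finset κ) (I : κ → Finset ι) :
    (prodBernoulli q).real {ω : Set ι | (S.filter fun b => ((I b : Finset ι) : Set ι) ⊆ ω).card = 1} ≤
        ∑ b ∈ S, ∏ i ∈ I b, (q i : ℝ) ∧
      ∑ b ∈ S, ∏ i ∈ I b, (q i : ℝ) ≤
        (prodBernoulli q).real {ω : Set ι | (S.filter fun b => ((I b : Finset ι) : Set ι) ⊆ ω).card = 1} +
          S.card * (prodBernoulli q).real {ω : Set ι | 2 ≤ (S.filter fun b => ((I b : Finset ι) : Set ι) ⊆ ω).card} := by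
  set μ := prodBernoulli q with hμ
  have hmeas : ∀ T : Set (Set ι), MeasurableSet T := fun T => (Set.toFinite T).measurableSet
  set E : κ → Set (Set ι) := fun b => {ω | ((I b : Finset ι) : Set ι) ⊆ ω} with hE
  set E1 := {ω : Set ι | (S.filter fun b => ((I b : Finset ι) : Set ι) ⊆ ω).card = 1} with hE1
  set E2 := {ω : Set ι | 2 ≤ (S.filter fun b => ((I b : Finset ι) : Set ι) ⊆ ω).card} with hE2
  have hP : ∀ b, μ.real (E b) = ∏ i ∈ I b, (q i : ℝ) := fun b => prodBernoulli_real_subset q (I b)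
  constructor
  · -- `{C = 1} ⊆ ⋃ E b`
    have hsub : E1 ⊆ ⋃ b ∈ S, E b := by
      intro ω hω
      have h1 : (S.filter fun b => ((I b : Finset ι) : Set ι) ⊆ ω).card = 1 := hω
      obtain ⟨b, hb⟩ := Finset.card_pos.1 (by rw [h1]; exact Nat.one_pos)
      rw [Finset.mem_filter] at hb
      exact Set.mem_biUnion (Finset.mem_coe.2 hb.1) hb.2
    calc μ.real E1 ≤ μ.real (⋃ b ∈ S, E b) := measureReal_mono hsub (measure_ne_top _ _)
      _ ≤ ∑ b ∈ S, μ.real (E b) := measureReal_biUnion_finset_le S E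
      _ = ∑ b ∈ S, ∏ i ∈ I b, (q i : ℝ) := Finset.sum_congr rfl fun b _ => hP b
  · -- `E b ⊆ (E b ∩ {C = 1}) ∪ {C ≥ 2}` and the `E b ∩ {C = 1}` are pairwise disjoint inside `{C = 1}`
    have hsplit : ∀ b ∈ S, μ.real (E b) ≤ μ.real (E b ∩ E1) + μ.real E2 := by
      intro b hb
      have hsub : E b ⊆ (E b ∩ E1) ∪ E2 := by
        intro ω hω
        have h1 : 1 ≤ (S.filter fun b => ((I b : Finset ι) : Set ι) ⊆ ω).card :=
          Finset.card_pos.2 ⟨b, Finset.mem_filter.2 ⟨hb, hω⟩⟩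
        by_cases h2 : 2 ≤ (S.filter fun b => ((I b : Finset ι) : Set ι) ⊆ ω).card
        · exact Or.inr h2
        · left
          refine ⟨hω, ?_⟩
          show (S.filter fun b => ((I b : Finset ι) : Set ι) ⊆ ω).card = 1
          omega
      calc μ.real (E b) ≤ μ.real ((E b ∩ E1) ∪ E2) := measureReal_mono hsub (measure_ne_top _ _)
        _ ≤ μ.real (E b ∩ E1) + μ.real E2 := measureReal_union_le _ _
    have hdisj : ((S : Set κ)).PairwiseDisjoint fun b => E b ∩ E1 := by
      intro b hb b' hb' hbb'
      rw [Function.onFun, Set.disjoint_left]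
      intro ω h h'
      have h1 : (S.filter fun b => ((I b : Finset ι) : Set ι) ⊆ ω).card = 1 := h.2
      have h2 : ({b, b'} : Finset κ) ⊆ S.filter fun b => ((I b : Finset ι) : Set ι) ⊆ ω := by
        intro c hc
        rw [Finset.mem_insert, Finset.mem_singleton] at hc
        rw [Finset.mem_filter]
        rcases hc with rfl | rfl
        · exact ⟨Finset.mem_coe.1 hb, h.1⟩
        · exact ⟨Finset.mem_coe.1 hb', h'.1⟩
      have := Finset.card_le_card h2
      rw [Finset.card_pair hbb'] at this
      omega
    have hU : ∑ b ∈ S, μ.real (E b ∩ E1) = μ.real (⋃ b ∈ S, (E b ∩ E1)) :=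
      (measureReal_biUnion_finset hdisj (fun b _ => hmeas _)).symm
    have hUle : μ.real (⋃ b ∈ S, (E b ∩ E1)) ≤ μ.real E1 :=
      measureReal_mono (Set.iUnion₂_subset fun b _ => Set.inter_subset_right) (measure_ne_top _ _)
    calc ∑ b ∈ S, ∏ i ∈ I b, (q i : ℝ) = ∑ b ∈ S, μ.real (E b) := Finset.sum_congr rfl fun b _ => (hP b).symm
      _ ≤ ∑ b ∈ S, (μ.real (E b ∩ E1) + μ.real E2) := Finset.sum_le_sum hsplit
      _ = ∑ b ∈ S, μ.real (E b ∩ E1) + S.card * μ.real E2 := by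
          rw [Finset.sum_add_distrib, Finset.sum_const, nsmul_eq_mul]
      _ ≤ μ.real E1 + S.card * μ.real E2 := by rw [hU]; linarith

/-- **One step down the chain (probabilities).**  In the situation of `two_le_count_eq`, if moreover `K` is disjoint from the inner
parts `I b` (`b ∈ S₁`) and these are disjoint from the sets `A y` (`y ∈ S₂`), then with `z, s, t = P(C = 0), P(C = 1), P(C ≥ 2)`:
`P(N ≥ 2) = π(K)·t + s·P(Y ≥ 1) + z·P(Y ≥ 2)` and `P(N ≥ 1) = π(K)·(1 − z) + z·P(Y ≥ 1)`. [this work] -/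
theorem chain_step_real (q : ι → unitInterval) (A I : κ → Finset ι) (K : Finset ι) (S₁ S₂ : Finset κ) (hdisj : Disjoint S₁ S₂)
    (hA₁ : ∀ b ∈ S₁, A b = K ∪ I b) (hA₂ : ∀ y ∈ S₂, K ⊆ A y) (hKI : ∀ b ∈ S₁, Disjoint K (I b))
    (hIA : ∀ b ∈ S₁, ∀ y ∈ S₂, Disjoint (I b) (A y)) :
    (prodBernoulli q).real {ω : Set ι | 2 ≤ ((S₁ ∪ S₂).filter fun y => ((A y : Finset ι) : Set ι) ⊆ ω).card} =
        (∏ i ∈ K, (q i : ℝ)) * (prodBernoulli q).real {ω : Set ι | 2 ≤ (S₁.filter fun b => ((I b : Finset ι) : Set ι) ⊆ ω).card} +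
          (prodBernoulli q).real {ω : Set ι | (S₁.filter fun b => ((I b : Finset ι) : Set ι) ⊆ ω).card = 1} *
            (prodBernoulli q).real {ω : Set ι | 1 ≤ (S₂.filter fun y => ((A y : Finset ι) : Set ι) ⊆ ω).card} +
          (prodBernoulli q).real {ω : Set ι | (S₁.filter fun b => ((I b : Finset ι) : Set ι) ⊆ ω).card = 0} *
            (prodBernoulli q).real {ω : Set ι | 2 ≤ (S₂.filter fun y => ((A y : Finset ι) : Set ι) ⊆ ω).card} ∧
      (prodBernoulli q).real {ω : Set ι | 1 ≤ ((S₁ ∪ S₂).filter fun y => ((A y : Finset ι) : Set ι) ⊆ ω).card} =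
        (∏ i ∈ K, (q i : ℝ)) *
            (1 - (prodBernoulli q).real {ω : Set ι | (S₁.filter fun b => ((I b : Finset ι) : Set ι) ⊆ ω).card = 0}) +
          (prodBernoulli q).real {ω : Set ι | (S₁.filter fun b => ((I b : Finset ι) : Set ι) ⊆ ω).card = 0} *
            (prodBernoulli q).real {ω : Set ι | 1 ≤ (S₂.filter fun y => ((A y : Finset ι) : Set ι) ⊆ ω).card} := by
  set μ := prodBernoulli q with hμ
  have hmeas : ∀ T : Set (Set ι), MeasurableSet T := fun T => (Set.toFinite T).measurableSet
  -- supports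
  set F : Finset ι := S₁.biUnion I with hF
  set R : Finset ι := S₂.biUnion A with hR
  have hKF : Disjoint K F := by
    rw [hF, Finset.disjoint_biUnion_right]; exact hKI
  have hFR : Disjoint F R := by
    rw [hF, Finset.disjoint_biUnion_left]
    intro b hb
    rw [hR, Finset.disjoint_biUnion_right]
    exact hIA b hb
  have hIF : ∀ b ∈ S₁, I b ⊆ F := fun b hb => Finset.subset_biUnion_of_mem I hb
  have hAR : ∀ y ∈ S₂, A y ⊆ R := fun y hy => Finset.subset_biUnion_of_mem A hy
  -- names for the events
  set EK := {ω : Set ι | ((K : Finset ι) : Set ι) ⊆ ω} with hEK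
  set C0 := {ω : Set ι | (S₁.filter fun b => ((I b : Finset ι) : Set ι) ⊆ ω).card = 0} with hC0
  set C1 := {ω : Set ι | (S₁.filter fun b => ((I b : Finset ι) : Set ι) ⊆ ω).card = 1} with hC1
  set C1' := {ω : Set ι | 1 ≤ (S₁.filter fun b => ((I b : Finset ι) : Set ι) ⊆ ω).card} with hC1'
  set C2 := {ω : Set ι | 2 ≤ (S₁.filter fun b => ((I b : Finset ι) : Set ι) ⊆ ω).card} with hC2
  set Y1 := {ω : Set ι | 1 ≤ (S₂.filter fun y => ((A y : Finset ι) : Set ι) ⊆ ω).card} with hY1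
  set Y2 := {ω : Set ι | 2 ≤ (S₂.filter fun y => ((A y : Finset ι) : Set ι) ⊆ ω).card} with hY2
  have hPK : μ.real EK = ∏ i ∈ K, (q i : ℝ) := prodBernoulli_real_subset q K
  have dK : DeterminedBy EK (↑K : Set ι) := determinedBy_subset_open K
  have dC : ∀ Φ : ℕ → Prop, DeterminedBy {ω : Set ι | Φ ((S₁.filter fun b => ((I b : Finset ι) : Set ι) ⊆ ω).card)} (↑F : Set ι) :=
    fun Φ => determinedBy_card_filter_open S₁ I F hIF Φ
  have dY : ∀ Φ : ℕ → Prop, DeterminedBy {ω : Set ι | Φ ((S₂.filter fun y => ((A y : Finset ι) : Set ι) ⊆ ω).card)} (↑R : Set ι) :=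
    fun Φ => determinedBy_card_filter_open S₂ A R hAR Φ
  -- the products
  have p1 : μ.real (EK ∩ C2) = μ.real EK * μ.real C2 :=
    prodBernoulli_real_inter_of_determinedBy_disjoint q hKF dK (dC fun c => 2 ≤ c) (hmeas _) (hmeas _)
  have p1' : μ.real (EK ∩ C1') = μ.real EK * μ.real C1' :=
    prodBernoulli_real_inter_of_determinedBy_disjoint q hKF dK (dC fun c => 1 ≤ c) (hmeas _) (hmeas _)
  have p2 : μ.real (C1 ∩ Y1) = μ.real C1 * μ.real Y1 :=
    prodBernoulli_real_inter_of_determinedBy_disjoint q hFR (dC fun c => c = 1) (dY fun c => 1 ≤ c) (hmeas _) (hmeas _)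
  have p3 : μ.real (C0 ∩ Y2) = μ.real C0 * μ.real Y2 :=
    prodBernoulli_real_inter_of_determinedBy_disjoint q hFR (dC fun c => c = 0) (dY fun c => 2 ≤ c) (hmeas _) (hmeas _)
  have p3' : μ.real (C0 ∩ Y1) = μ.real C0 * μ.real Y1 :=
    prodBernoulli_real_inter_of_determinedBy_disjoint q hFR (dC fun c => c = 0) (dY fun c => 1 ≤ c) (hmeas _) (hmeas _)
  have hC1c : μ.real C1' = 1 - μ.real C0 := by
    have : C1' = C0ᶜ := by
      ext ω; simp only [hC1', hC0, Set.mem_setOf_eq, Set.mem_compl_iff]; omega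
    rw [this, probReal_compl_eq_one_sub (hmeas _)]
  constructor
  · rw [two_le_count_eq A I K S₁ S₂ hdisj hA₁ hA₂]
    have hd12 : Disjoint (EK ∩ C2) (C1 ∩ Y1) := by
      rw [Set.disjoint_left]; intro ω h h'
      have a := h.2; have b := h'.1
      simp only [hC2, hC1, Set.mem_setOf_eq] at a b; omega
    have hd3 : Disjoint ((EK ∩ C2) ∪ (C1 ∩ Y1)) (C0 ∩ Y2) := by
      rw [Set.disjoint_left]; intro ω h h'
      have c := h'.1
      simp only [hC0, Set.mem_setOf_eq] at c
      rcases h with h | h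
      · have a := h.2; simp only [hC2, Set.mem_setOf_eq] at a; omega
      · have b := h.1; simp only [hC1, Set.mem_setOf_eq] at b; omega
    rw [measureReal_union hd3 (hmeas _), measureReal_union hd12 (hmeas _), p1, p2, p3, hPK]
  · rw [one_le_count_eq A I K S₁ S₂ hdisj hA₁ hA₂]
    have hd : Disjoint (EK ∩ C1') (C0 ∩ Y1) := by
      rw [Set.disjoint_left]; intro ω h h'
      have a := h.2; have c := h'.1
      simp only [hC1', hC0, Set.mem_setOf_eq] at a c; omega
    rw [measureReal_union hd (hmeas _), p1', p3', hPK, hC1c]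

end Quant

end Summit.CriticalPhenomena.PercolationContinuityZ3.Theorems

end
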